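import Summits.Ventures.HSemireg.WedgeC15

/-!
# Venture HSemireg — C15 on the contraction carrier (2/4): rank transport and the exponential-sum laws

HONEST FRAMING. Part of the Lean index of the computation cell `pub-hsemireg` (seat p3; Sunday enclosure of the
FORMULA-N kernel assets of seats th-7 / th-6, ENCLOSURE-PLAN-p3.md).  Finite-dimensional exterior algebra over a field ONLY:
no variety, no cohomology theory, no semiregularity map is constructed here; nothing here says that HC / HC_CM / HC_AV holds;
no Literature fact is declared or used.  The geometric DICTIONARY (why these ranks are the `HT`-side box ranks of the cell's
STRUCTURE.md §1 / theory/FORMULA-N.md) lives in theory/FORMULA-N-th7.md PART B §A.3 / §N and is NOT asserted in Lean.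

th-7's ASSEMBLY, file 2 of 4 (theory/th7/WedgeC15.lean v1.4 sha256/16 45d63ee04200ecae (th-7 g3, 17:55Z; PART III = l.2277–2921), l.2544–2640, VERBATIM up to namespaces):
`w_congr'` (`w_m` reads only `q_0..q_m`), `Ψ_xprod_eq = w_k(δ_k)`, `Ψ_yprod_eq = w_k(δ_0)`; RANK TRANSPORT `map_Ψ_range_ι` / `map_Ψ_exteriorPower` /
`map_Ψ_range_wedge` / `finrank_range_wedge_eq`; the LAWS for EXPONENTIAL SUMS: **`finrank_S_expSum_eq_hankel`** — `dim S_k(Σ_i c_i · Π_a (1 + λ_i ℓ_a ∧ m_a))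
= C(n,k) · rank H_k(q)`, `q_m = Σ_i c_i λ_i^m` (every field, n, k, finite family); **`finrank_contractionSpan_expSum_eq_hankel`** (k = 2, the tree's
`ContractionSpan.span ↑L ↑(Ann L) x` LITERALLY); **`finrank_S_pointPair_eq_hankel`** (`dim S_k(a·1 + b·ω_V) = C(n,k) · rank H_k(a,0,…,0,b)`).
General coefficient sequences and the point pair BY VALUE: files 3–4 (`WedgeCarrierEcl.lean`, `WedgeC15General.lean`).
-/

open Module Set Set.powersetCard

namespace Summit.Ventures.HSemireg.WedgeC15

open Module Summit.Ventures.HSemireg.WedgeBridge Summit.Ventures.HSemireg.Wedge Summit.Ventures.HSemireg.Wedge.Hankel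
open CliffordAlgebra (contractLeft)
open ExteriorAlgebra (ι)

variable {K : Type*} [Field K] {n : ℕ} {V : Type*} [AddCommGroup V] [Module K V] (bV : Basis (Fin (n + n)) K V)

/-- `w_m` only reads `q_0, …, q_m`. -/
lemma w_congr' : ∀ (m : ℕ) {q q' : ℕ → K}, (∀ j ≤ m, q j = q' j) → w K n m q = w K n m q'
  | 0, _, _, h => by rw [w, w, h 0 le_rfl]
  | m + 1, _, _, h => by
    rw [w, w, w_congr' m (fun j hj => h j (by omega)),
      w_congr' m (q := shift K _) (q' := shift K _) (fun j hj => h (j + 1) (by omega))]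

/-- `Ψ(x_0 ⋯ x_{k-1}) = w_k(δ_k) (= y_0 ⋯ y_{k-1} in HankelRank's letters)`. -/
theorem Ψ_xprod_eq : ∀ k : ℕ, Ψ bV (xprod bV k) = w K n k (fun m => if m = k then (1 : K) else 0)
  | 0 => by rw [xprod, map_one, w, if_pos rfl, one_smul]
  | k + 1 => by
    have h0 : w K n k (fun m => if m = k + 1 then (1 : K) else 0) = 0 := by
      rw [w_congr' (K := K) k (q' := fun _ => (0 : K)) (fun j hj => if_neg (by omega)), w_zero]
    have hs : shift K (fun m => if m = k + 1 then (1 : K) else 0) = fun m => if m = k then (1 : K) else 0 := by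
      funext m; simp only [shift_apply, add_left_inj]
    rw [xprod, map_mul, Ψ_xprod_eq k, Ψ_XN, w, h0, zero_mul, zero_add, hs]

/-- `Ψ(y_0 ⋯ y_{k-1}) = w_k(δ_0) (= x_0 ⋯ x_{k-1} in HankelRank's letters)`. -/
theorem Ψ_yprod_eq : ∀ k : ℕ, Ψ bV (yprod bV k) = w K n k (fun m => if m = 0 then (1 : K) else 0)
  | 0 => by rw [yprod, map_one, w, if_pos rfl, one_smul]
  | k + 1 => by
    have hs : shift K (fun m => if m = 0 then (1 : K) else 0) = fun _ => 0 := by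
      funext m; simp only [shift_apply]; rw [if_neg (Nat.succ_ne_zero m)]
    rw [yprod, map_mul, Ψ_yprod_eq k, Ψ_YN, w, hs, w_zero, zero_mul, add_zero]

/-! ### transporting ranks along `Ψ` -/

/-- `Ψ e` maps the generators onto the generators. -/
lemma map_Ψ_range_ι :
    Submodule.map (Ψ bV).toLinearMap (LinearMap.range (ι K : W K (Lsp bV) →ₗ[K] _)) =
      LinearMap.range (ι K : (In n → K) →ₗ[K] _) := by
  rw [← LinearMap.range_comp]
  have h : (Ψ bV).toLinearMap ∘ₗ (ι K : W K (Lsp bV) →ₗ[K] _) =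
      (ι K : (In n → K) →ₗ[K] _) ∘ₗ (gequiv bV).symm.toLinearMap := by
    refine LinearMap.ext fun m => ?_
    simp only [LinearMap.coe_comp, Function.comp_apply, LinearEquiv.coe_coe]
    exact Ψ_ι bV m
  rw [h, LinearMap.range_comp_of_range_eq_top _ (LinearEquiv.range (gequiv bV).symm)]

/-- `Ψ e` maps `⋀^k` onto `⋀^k`. -/
lemma map_Ψ_exteriorPower (k : ℕ) :
    Submodule.map (Ψ bV).toLinearMap (⋀[K]^k (W K (Lsp bV))) = ⋀[K]^k (In n → K) := by
  show Submodule.map (Ψ bV).toAlgHom.toLinearMap (LinearMap.range (ι K) ^ k) = LinearMap.range (ι K) ^ k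
  rw [Submodule.map_pow, show (Ψ bV).toAlgHom.toLinearMap = (Ψ bV).toLinearMap from rfl, map_Ψ_range_ι]

/-- `Ψ` carries the range of the bridge's `θ ↦ θ ∧ v` onto the range of HankelRank's `θ ↦ θ ∧ Ψ v`. -/
lemma map_Ψ_range_wedge (k : ℕ) (v : ExteriorAlgebra K (W K (Lsp bV))) :
    Submodule.map (Ψ bV).toLinearMap (LinearMap.range (WedgeBridge.wedge K (Lsp bV) k v)) =
      LinearMap.range (Wedge.Hankel.wedge K n k (Ψ bV v)) := by
  rw [WedgeBridge.wedge, Wedge.Hankel.wedge, LinearMap.range_comp, LinearMap.range_comp,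
    Submodule.range_subtype, Submodule.range_subtype, ← map_Ψ_exteriorPower bV k, ← Submodule.map_comp,
    ← Submodule.map_comp]
  congr 1
  refine LinearMap.ext fun x => ?_
  simp only [LinearMap.coe_comp, Function.comp_apply, LinearMap.mulRight_apply, AlgEquiv.toLinearMap_apply,
    map_mul]

/-- ranks of `θ ↦ θ ∧ (−)` are `Ψ`-invariant. -/
lemma finrank_range_wedge_eq (k : ℕ) (v : ExteriorAlgebra K (W K (Lsp bV))) :
    Module.finrank K (LinearMap.range (WedgeBridge.wedge K (Lsp bV) k v)) =
      Module.finrank K (LinearMap.range (Wedge.Hankel.wedge K n k (Ψ bV v))) := by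
  rw [← map_Ψ_range_wedge, LinearEquiv.finrank_map_eq (Ψ bV).toLinearEquiv]

/-! ### THE ASSEMBLED THEOREMS -/

/-- **C15 ON THE CARRIER (THEOREM H for `contractionRank`-type spans), EVERY degree.** For an adapted basis
(`ℓ_a, m_a`, `L = span ℓ`, `Θ := Σ_a ℓ_a ∧ m_a`) and every finite exponential sum `x = Σ_i c_i exp(λ_i Θ)`
(written `Σ_i c_i Π_a (1 + λ_i ℓ_a ∧ m_a)`): `dim S_k(x) = C(n,k) · rank H_k(q)`, `q_m = Σ_i c_i λ_i^m`,
`H_k(q) = (q_{i+s})_{i ≤ k, s ≤ n-k}` — where `S_k(x) = ρ(Λ^k(L × Ann L))·x` is the degree-`k` contraction span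
(`S_2 =` the tree's `ContractionSpan.span`, next theorem). Every field, every `n`, `k`. -/
theorem finrank_S_expSum_eq_hankel {ι' : Type*} (s : Finset ι') (c lam : ι' → K) (k : ℕ) :
    Module.finrank K (WedgeBridge.S K (Lsp bV) k (∑ i ∈ s, c i • Eprod bV (lam i) n)) =
      n.choose k * (hankel1 K n k (fun m => ∑ i ∈ s, c i * lam i ^ m)).rank := by
  rw [finrank_S_expSum bV s c lam k, finrank_range_wedge_eq, Ψ_expSum, hankelLaw_model]

/-- the same in degree 2, stated for the TREE's `ContractionSpan.span ↑L ↑(Ann L) x` literally. -/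
theorem finrank_contractionSpan_expSum_eq_hankel {ι' : Type*} (s : Finset ι') (c lam : ι' → K) :
    Module.finrank K (Summit.Ventures.HSemireg.ContractionSpan.span (Lsp bV : Set V)
        ((Lsp bV).dualAnnihilator : Set (Module.Dual K V)) (∑ i ∈ s, c i • Eprod bV (lam i) n)) =
      n.choose 2 * (hankel1 K n 2 (fun m => ∑ i ∈ s, c i * lam i ^ m)).rank := by
  rw [← S_two_eq, finrank_S_expSum_eq_hankel]

/-- **THE POINT PAIR ON THE CARRIER** (`ch(I_p) = 1 - pt` up to units): `dim S_k(a·1 + b·ω_V) = C(n,k) · rank H_k(q)`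
for the two-ended sequence `q = (a, 0, …, 0, b)`, `ω_V = ℓ_0 ∧ ⋯ ∧ ℓ_{n-1} ∧ ω` a top form. -/
theorem finrank_S_pointPair_eq_hankel (a b : K) (k : ℕ) :
    Module.finrank K (WedgeBridge.S K (Lsp bV) k (algebraMap K _ a + b • (ellprod bV n * vacuum bV))) =
      n.choose k * (hankel1 K n k (fun m => (if m = 0 then a else 0) + (if m = n then b else 0))).rank := by
  have hw : a • w K n n (fun m => if m = 0 then (1 : K) else 0) + b • w K n n (fun m => if m = n then (1 : K) else 0)
      = w K n n (fun m => (if m = 0 then a else 0) + (if m = n then b else 0)) := by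
    rw [← w_smul, ← w_smul, ← w_add]
    congr 1
    funext m
    split_ifs <;> simp
  rw [finrank_S_pointPair bV a b k, finrank_range_wedge_eq, map_add, map_smul, map_smul, Ψ_yprod_eq, Ψ_xprod_eq,
    hw, hankelLaw_model]

/-! ### GENERAL COEFFICIENT SEQUENCES: `v(q) = Σ_m q_m E_m` (not only exponential sums) -/

end Summit.Ventures.HSemireg.WedgeC15
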